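import Mathlib
import HarnessLib
import Literature.NumberTheory.DiophantineGeometry.AbcWave0QualityFormProofs
import Summits.ABC.ABC.Theses.FeketeScales

/-!
# Route FeketeScales — the Assembly `ScaleSubmultiplicativity → SparseGoodScales → ABC`

Item stmt-ABC-2165 (assembly of route `FeketeScales`, closes `--workitem stmt-ABC-2165`): the
Fekete-type upgrade "sub-multiplicativity of the abc extremal height across radical scales + abc at
ONE sufficiently large good scale ⇒ abc at every scale", proved unconditionally (elementary real
analysis; no S-unit / finiteness theorem is needed because the hypotheses are stated `G`-free).

## The argument (finitary Fekete lemma with a sub-power error term)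

Write `P S X` for "every abc triple with `rad(abc) ≤ S` has `c ≤ X`". After normalising the
crux (`submult_normalise`: WLOG `0 ≤ θ < 1`, `K = e^L` with `L ≥ 0`, scales `≥ 2`), the crux says
that `P` is sub-multiplicative, `P S₁ X₁ → P S₂ X₂ → P (S₁S₂) (e^L e^{(log S₁S₂)^θ} X₁ X₂)` for
`S₁, S₂ ≥ R₀`, and a good scale `R` of `SparseGoodScales δ` is `P R (R^{1+δ})`.

* `doubling`: along `R^(2^i)`, `P (R^(2^i)) (exp (2^i (b + β) - β (2^i)^θ))` as soon as
  `L + 2^θ (log R)^θ ≤ β (2 - 2^θ)` — the defect `-β (2^i)^θ` pays for the slack of each doubling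
  (this is where `θ < 1`, i.e. `2^θ < 2`, enters).
* `allScales`: for every `N ≥ 1`, `P (R^N) (exp (N (b + β) + γ N^φ))` with `φ = (1+θ)/2` and
  `L + (log R)^θ ≤ γ (1 - 2^{-φ})`: split off the top binary digit, `N = 2^i + M`, `M ≤ N/2`; the
  gain `γ (N^φ - M^φ) ≥ γ (1 - 2^{-φ}) N^φ` pays the slack `L + (N log R)^θ`, so no `log₂ N` factor
  appears.
* `abc_of_submult_of_sparseGoodScales`: given `ε`, put `δ = ε/3`, take the good scale `R` so large
  that `β = δ log R` is admissible (`rpow_le_linear_add_const`: `t^θ ≤ a t + B`), bound a triple of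
  radical `r` through the least `N` with `r ≤ R^N` (`Nat.clog`; `(N-1) log R < log r`) and absorb
  `γ N^φ ≤ δ N log R + γ B₂` (sublinearity again): `log c ≤ (1 + 3δ) log r + B'`, so
  `c < 2 e^{B'} rad(abc)^{1+ε}`.

Pattern: M. Fekete (1923), Math. Z. 17, and the de Bruijn–Erdős (1952) error-term version of the
subadditive lemma; Mathlib's `Subadditive.tendsto_lim` is the qualitative limit statement and is not
used — everything here is finitary with explicit constants. No new definitions; standard axioms.
-/

-- `Summit.<Summit>.<Problem>` is the mandated summit-side namespace (CONVENTIONS §2); for the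
-- single-conjunct summit `ABC` the two coincide, so the duplicate `ABC.ABC` is deliberate.
set_option linter.dupNamespace false

namespace Summit.ABC.ABC.Theorems.FeketeScalesAssembly

open Literature.NumberTheory.DiophantineGeometry

/-- Sublinearity of `y ↦ y ^ φ` for `0 ≤ φ < 1`, in the explicit form used twice below: for every
slope `a > 0` there is an intercept `B ≥ 0` with `y ^ φ ≤ a * y + B` for all `y ≥ 0` (threshold
`M = a ^ (1/(φ-1))`: above it `y ^ φ = y ^ (φ - 1) * y ≤ a * y`, below it `y ^ φ ≤ M ^ φ`).
[folklore] -/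
theorem rpow_le_linear_add_const {φ a : ℝ} (hφ0 : 0 ≤ φ) (hφ1 : φ < 1) (ha : 0 < a) :
    ∃ B : ℝ, 0 ≤ B ∧ ∀ y : ℝ, 0 ≤ y → y ^ φ ≤ a * y + B := by
  have hne : φ - 1 ≠ 0 := by linarith
  set M : ℝ := a ^ (φ - 1)⁻¹ with hM
  have hMpos : 0 < M := Real.rpow_pos_of_pos ha _
  have hMa : M ^ (φ - 1) = a := by
    rw [hM, Real.rpow_inv_rpow ha.le hne]
  refine ⟨M ^ φ, Real.rpow_nonneg hMpos.le _, fun y hy => ?_⟩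
  rcases le_or_gt y M with hyM | hyM
  · have h1 : y ^ φ ≤ M ^ φ := Real.rpow_le_rpow hy hyM hφ0
    have h2 : 0 ≤ a * y := mul_nonneg ha.le hy
    linarith
  · have hypos : 0 < y := hMpos.trans hyM
    have h1 : y ^ φ = y ^ (φ - 1) * y := by
      have := Real.rpow_add hypos (φ - 1) 1
      rw [Real.rpow_one] at this
      rw [← this]; ring_nf
    have h2 : y ^ (φ - 1) ≤ M ^ (φ - 1) :=
      Real.rpow_le_rpow_of_nonpos hMpos hyM.le (by linarith)
    rw [h1, hMa] at *
    have h3 : y ^ (φ - 1) * y ≤ a * y := by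
      rw [hMa] at h2
      exact mul_le_mul_of_nonneg_right h2 hy
    have h4 : 0 ≤ M ^ φ := Real.rpow_nonneg hMpos.le _
    linarith

/-- **Doubling step of the Fekete iteration** (abstract form). `P S X` is to be read "every abc
triple with radical `≤ S` has `c ≤ X`". If `P` is monotone in `X`, sub-multiplicative across
scales `S₁, S₂ ≥ R₀` with slack `e^L · e^{(log S₁S₂)^θ}` (`0 ≤ θ`, `0 ≤ L`), and `P R (e^b)` holds
at one scale `R ≥ max R₀ 1`, then along the scales `R^(2^i)` the normalised exponent stays below
`b + β` for any `β` with `L + 2^θ (log R)^θ ≤ β (2 - 2^θ)`: precisely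
`P (R^(2^i)) (exp (2^i (b + β) - β (2^i)^θ))`.
(Induction on `i`; the defect `-β (2^i)^θ` absorbs the slack of each doubling.) [folklore] -/
theorem doubling (P : ℕ → ℝ → Prop) {θ L b β : ℝ} {R₀ R : ℕ}
    (hθ0 : 0 ≤ θ) (hL : 0 ≤ L) (hR₀ : R₀ ≤ R) (hR1 : 1 ≤ R)
    (hβ : L + (2:ℝ) ^ θ * (Real.log R) ^ θ ≤ β * (2 - (2:ℝ) ^ θ))
    (mono : ∀ S : ℕ, ∀ X Y : ℝ, P S X → X ≤ Y → P S Y)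
    (mul : ∀ S₁ S₂ : ℕ, R₀ ≤ S₁ → R₀ ≤ S₂ → ∀ X₁ X₂ : ℝ, 0 ≤ X₁ → 0 ≤ X₂ → P S₁ X₁ → P S₂ X₂ →
      P (S₁ * S₂) (Real.exp L * Real.exp (Real.log ((S₁ : ℝ) * S₂) ^ θ) * X₁ * X₂))
    (base : P R (Real.exp b)) :
    ∀ i : ℕ, P (R ^ 2 ^ i) (Real.exp ((2:ℝ) ^ i * (b + β) - β * ((2:ℝ) ^ i) ^ θ)) := by
  have ht : 0 ≤ Real.log R := Real.log_nonneg (by exact_mod_cast hR1)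
  intro i
  induction i with
  | zero => simpa using base
  | succ i ih =>
    have hRi : R₀ ≤ R ^ 2 ^ i := hR₀.trans (Nat.le_self_pow (pow_ne_zero _ two_ne_zero) R)
    have hpow : R ^ 2 ^ i * R ^ 2 ^ i = R ^ 2 ^ (i + 1) := by
      rw [← pow_add, ← two_mul, ← pow_succ']
    have h := mul _ _ hRi hRi _ _ (Real.exp_pos _).le (Real.exp_pos _).le ih ih
    rw [hpow] at h
    refine mono _ _ _ h ?_
    have hl : Real.log (((R ^ 2 ^ i : ℕ) : ℝ) * ((R ^ 2 ^ i : ℕ) : ℝ)) =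
        (2:ℝ) ^ (i + 1) * Real.log R := by
      rw [← Nat.cast_mul, hpow, Nat.cast_pow, Real.log_pow]; push_cast; ring
    rw [hl, ← Real.exp_add, ← Real.exp_add, ← Real.exp_add, Real.exp_le_exp]
    have h2i : (0:ℝ) ≤ (2:ℝ) ^ i := by positivity
    have hsplit : ((2:ℝ) ^ (i + 1) * Real.log R) ^ θ =
        ((2:ℝ) ^ i) ^ θ * (2:ℝ) ^ θ * (Real.log R) ^ θ := by
      rw [Real.mul_rpow (by positivity) ht, pow_succ, Real.mul_rpow h2i (by norm_num)]
    have hsplit' : ((2:ℝ) ^ (i + 1)) ^ θ = ((2:ℝ) ^ i) ^ θ * (2:ℝ) ^ θ := by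
      rw [pow_succ, Real.mul_rpow h2i (by norm_num)]
    rw [hsplit, hsplit', pow_succ]
    set u : ℝ := ((2:ℝ) ^ i) ^ θ
    have hu : 1 ≤ u := Real.one_le_rpow (one_le_pow₀ (by norm_num)) hθ0
    have hu0 : 0 ≤ u := zero_le_one.trans hu
    have hβu := mul_le_mul_of_nonneg_right hβ hu0
    have hLu : L ≤ L * u := le_mul_of_one_le_right hL hu
    nlinarith [hβu, hLu]

/-- **All scales from the dyadic ones** (abstract form, binary splitting by the top bit). Under the
hypotheses of `doubling`, if moreover `θ ≤ φ` and `L + (log R)^θ ≤ γ (1 - 2^{-φ})` with `β, γ ≥ 0`,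
then `P (R^N) (exp (N (b + β) + γ N^φ))` for every `N ≥ 1`: write `N = 2^i + M` with `M < 2^i`,
combine the dyadic bound at `2^i` with the inductive bound at `M ≤ N/2`; since `M^φ ≤ 2^{-φ} N^φ`
the per-step slack `L + (N log R)^θ ≤ (L + (log R)^θ) N^φ` is paid by the gain `γ (1 - 2^{-φ}) N^φ`,
so no `log₂ N` factor appears. [folklore] -/
theorem allScales (P : ℕ → ℝ → Prop) {θ φ L b β γ : ℝ} {R₀ R : ℕ}
    (hθ0 : 0 ≤ θ) (hθφ : θ ≤ φ) (hL : 0 ≤ L) (hβ0 : 0 ≤ β) (hγ0 : 0 ≤ γ)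
    (hR₀ : R₀ ≤ R) (hR1 : 1 ≤ R)
    (hβ : L + (2:ℝ) ^ θ * (Real.log R) ^ θ ≤ β * (2 - (2:ℝ) ^ θ))
    (hγ : L + (Real.log R) ^ θ ≤ γ * (1 - (2:ℝ) ^ (-φ)))
    (mono : ∀ S : ℕ, ∀ X Y : ℝ, P S X → X ≤ Y → P S Y)
    (mul : ∀ S₁ S₂ : ℕ, R₀ ≤ S₁ → R₀ ≤ S₂ → ∀ X₁ X₂ : ℝ, 0 ≤ X₁ → 0 ≤ X₂ → P S₁ X₁ → P S₂ X₂ →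
      P (S₁ * S₂) (Real.exp L * Real.exp (Real.log ((S₁ : ℝ) * S₂) ^ θ) * X₁ * X₂))
    (base : P R (Real.exp b)) :
    ∀ N : ℕ, 1 ≤ N → P (R ^ N) (Real.exp (N * (b + β) + γ * (N : ℝ) ^ φ)) := by
  have hD := doubling P hθ0 hL hR₀ hR1 hβ mono mul base
  have ht : 0 ≤ Real.log R := Real.log_nonneg (by exact_mod_cast hR1)
  have hφ0 : 0 ≤ φ := hθ0.trans hθφ
  intro N
  induction N using Nat.strong_induction_on with
  | h N ih =>
    intro hN
    have hN0 : N ≠ 0 := by omega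
    set i : ℕ := Nat.log 2 N
    have h1 : 2 ^ i ≤ N := Nat.pow_log_le_self 2 hN0
    have h2 : N < 2 ^ (i + 1) := Nat.lt_pow_succ_log_self one_lt_two N
    set M : ℕ := N - 2 ^ i
    have hNM : 2 ^ i + M = N := Nat.add_sub_of_le h1
    have hMlt : M < 2 ^ i := by rw [pow_succ] at h2; omega
    have hRi : R₀ ≤ R ^ 2 ^ i := hR₀.trans (Nat.le_self_pow (pow_ne_zero _ two_ne_zero) R)
    have hNreal : (1:ℝ) ≤ N := by exact_mod_cast hN
    have hNφ : 1 ≤ (N:ℝ) ^ φ := Real.one_le_rpow hNreal hφ0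
    have hu0 : 0 ≤ β * ((2:ℝ) ^ i) ^ θ := mul_nonneg hβ0 (Real.rpow_nonneg (by positivity) _)
    rcases Nat.eq_zero_or_pos M with hM0 | hMpos
    · -- `N = 2 ^ i` is dyadic: the doubling bound, weakened.
      have hNi : N = 2 ^ i := by omega
      have h := hD i
      rw [← hNi] at h
      refine mono _ _ _ h (Real.exp_le_exp.2 ?_)
      have hcast : (N:ℝ) = (2:ℝ) ^ i := by rw [hNi]; push_cast; ring
      have hγN : 0 ≤ γ * (N:ℝ) ^ φ := mul_nonneg hγ0 (zero_le_one.trans hNφ)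
      rw [← hcast] at hu0 ⊢
      linarith
    · -- `N = 2 ^ i + M` with `1 ≤ M < 2 ^ i`: peel off the top bit.
      have hMN : M < N := by omega
      have hPM := ih M hMN hMpos
      have hRM : R₀ ≤ R ^ M := hR₀.trans (Nat.le_self_pow (by omega) R)
      have h := mul _ _ hRi hRM _ _ (Real.exp_pos _).le (Real.exp_pos _).le (hD i) hPM
      have hpow : R ^ 2 ^ i * R ^ M = R ^ N := by rw [← pow_add, hNM]
      rw [hpow] at h
      refine mono _ _ _ h ?_
      have hl : Real.log (((R ^ 2 ^ i : ℕ) : ℝ) * ((R ^ M : ℕ) : ℝ)) = (N:ℝ) * Real.log R := by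
        rw [← Nat.cast_mul, hpow, Nat.cast_pow, Real.log_pow]
      rw [hl, ← Real.exp_add, ← Real.exp_add, ← Real.exp_add, Real.exp_le_exp]
      have hN0' : (0:ℝ) ≤ N := by positivity
      -- the slack `(N log R)^θ ≤ N^φ (log R)^θ`
      have hA : ((N:ℝ) * Real.log R) ^ θ ≤ (N:ℝ) ^ φ * (Real.log R) ^ θ := by
        rw [Real.mul_rpow hN0' ht]
        exact mul_le_mul_of_nonneg_right (Real.rpow_le_rpow_of_exponent_le hNreal hθφ)
          (Real.rpow_nonneg ht _)
      -- `M ≤ N / 2`, so `M^φ ≤ 2^{-φ} N^φ`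
      have hM2 : (M:ℝ) ≤ (N:ℝ) * 2⁻¹ := by
        have : (2:ℝ) * M ≤ N := by exact_mod_cast (show 2 * M ≤ N by omega)
        linarith
      have hB : (M:ℝ) ^ φ ≤ (N:ℝ) ^ φ * (2:ℝ) ^ (-φ) := by
        have := Real.rpow_le_rpow (by positivity) hM2 hφ0
        rwa [Real.mul_rpow hN0' (by norm_num), Real.inv_rpow (by norm_num : (0:ℝ) ≤ 2),
          ← Real.rpow_neg (by norm_num : (0:ℝ) ≤ 2)] at this
      have hB' := mul_le_mul_of_nonneg_left hB hγ0
      have hC : L ≤ L * (N:ℝ) ^ φ := le_mul_of_one_le_right hL hNφ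
      have hγN := mul_le_mul_of_nonneg_right hγ (zero_le_one.trans hNφ)
      have hcast : (N:ℝ) * (b + β) = (2:ℝ) ^ i * (b + β) + (M:ℝ) * (b + β) := by
        rw [← hNM]; push_cast; ring
      nlinarith [hA, hB', hC, hγN, hcast, hu0, Real.rpow_nonneg ht θ]

/-- **Normalisation of the crux.** From `ScaleSubmultiplicativity` data `(θ, K, R₀)` one may pass to
`θ' = max θ 0 ≥ 0`, `K' = e^{max (log K) 0} ≥ K` and `R₀' = max R₀ 2`: for `R₁, R₂ ≥ 2` one has
`log (R₁ R₂) ≥ log 4 > 1`, so `(log R₁R₂)^θ ≤ (log R₁R₂)^{θ'}`. [folklore] -/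
theorem submult_normalise {θ K : ℝ} {R₀ : ℕ} (hK : 0 < K)
    (h : ∀ R₁ R₂ : ℕ, R₀ ≤ R₁ → R₀ ≤ R₂ → ∀ a b c : ℕ, IsABCTriple a b c → rad a b c ≤ R₁ * R₂ →
      ∃ a₁ b₁ c₁ a₂ b₂ c₂ : ℕ, IsABCTriple a₁ b₁ c₁ ∧ rad a₁ b₁ c₁ ≤ R₁ ∧ IsABCTriple a₂ b₂ c₂ ∧
        rad a₂ b₂ c₂ ≤ R₂ ∧ (c : ℝ) ≤ K * Real.exp (Real.log ((R₁ : ℝ) * R₂) ^ θ) * c₁ * c₂) :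
    ∀ R₁ R₂ : ℕ, max R₀ 2 ≤ R₁ → max R₀ 2 ≤ R₂ → ∀ a b c : ℕ, IsABCTriple a b c →
      rad a b c ≤ R₁ * R₂ →
      ∃ a₁ b₁ c₁ a₂ b₂ c₂ : ℕ, IsABCTriple a₁ b₁ c₁ ∧ rad a₁ b₁ c₁ ≤ R₁ ∧ IsABCTriple a₂ b₂ c₂ ∧
        rad a₂ b₂ c₂ ≤ R₂ ∧ (c : ℝ) ≤ Real.exp (max (Real.log K) 0) *
          Real.exp (Real.log ((R₁ : ℝ) * R₂) ^ (max θ 0)) * c₁ * c₂ := by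
  intro R₁ R₂ hR₁ hR₂ a b c habc hrad
  obtain ⟨a₁, b₁, c₁, a₂, b₂, c₂, h₁, hr₁, h₂, hr₂, hc⟩ :=
    h R₁ R₂ ((le_max_left _ _).trans hR₁) ((le_max_left _ _).trans hR₂) a b c habc hrad
  refine ⟨a₁, b₁, c₁, a₂, b₂, c₂, h₁, hr₁, h₂, hr₂, hc.trans ?_⟩
  have h2R₁ : (2:ℝ) ≤ R₁ := by exact_mod_cast (le_max_right _ _).trans hR₁
  have h2R₂ : (2:ℝ) ≤ R₂ := by exact_mod_cast (le_max_right _ _).trans hR₂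
  -- `log (R₁ R₂) ≥ 1` because `R₁ R₂ ≥ 4 > e`
  have hlog : 1 ≤ Real.log ((R₁ : ℝ) * R₂) := by
    rw [Real.le_log_iff_exp_le (by positivity)]
    have he : Real.exp 1 < 3 := Real.exp_one_lt_three
    nlinarith
  have hK' : K ≤ Real.exp (max (Real.log K) 0) := by
    calc K = Real.exp (Real.log K) := (Real.exp_log hK).symm
      _ ≤ Real.exp (max (Real.log K) 0) := Real.exp_le_exp.2 (le_max_left _ _)
  have hθ' : Real.exp (Real.log ((R₁ : ℝ) * R₂) ^ θ) ≤
      Real.exp (Real.log ((R₁ : ℝ) * R₂) ^ (max θ 0)) :=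
    Real.exp_le_exp.2 (Real.rpow_le_rpow_of_exponent_le hlog (le_max_left _ _))
  gcongr

/-- **The Fekete upgrade, normalised form.** If abc triples are sub-multiplicative across radical
scales `≥ R₀` with slack `e^L e^{(log R₁R₂)^θ}` (`0 ≤ θ < 1`, `0 ≤ L`) and abc holds with exponent
`1 + δ` at arbitrarily large single scales (`SparseGoodScales`), then the abc conjecture holds.
Proof: for `ε > 0` put `δ = ε/3`; choose a good scale `R ≥ max R₀ 2` so large that
`L + 2^θ (log R)^θ ≤ δ (2 - 2^θ) log R`; `allScales` (with `b = (1+δ) log R`, `β = δ log R`,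
`φ = (1+θ)/2`) bounds every triple with `rad ≤ R^N` by `exp (N (1+2δ) log R + γ N^φ)`; for a triple
with radical `r` the least such `N` has `(N-1) log R < log r`, and `γ N^φ ≤ δ N log R + γ B`
(sublinearity), whence `log c ≤ (1+3δ) log r + B'`, i.e. `c < 2 e^{B'} r^{1+ε}`. [folklore] -/
theorem abc_of_submult_of_sparseGoodScales {θ L : ℝ} {R₀ : ℕ} (hθ0 : 0 ≤ θ) (hθ1 : θ < 1)
    (hL : 0 ≤ L)
    (hsub : ∀ R₁ R₂ : ℕ, R₀ ≤ R₁ → R₀ ≤ R₂ → ∀ a b c : ℕ, IsABCTriple a b c → rad a b c ≤ R₁ * R₂ →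
      ∃ a₁ b₁ c₁ a₂ b₂ c₂ : ℕ, IsABCTriple a₁ b₁ c₁ ∧ rad a₁ b₁ c₁ ≤ R₁ ∧ IsABCTriple a₂ b₂ c₂ ∧
        rad a₂ b₂ c₂ ≤ R₂ ∧
        (c : ℝ) ≤ Real.exp L * Real.exp (Real.log ((R₁ : ℝ) * R₂) ^ θ) * c₁ * c₂)
    (hgood : ∀ δ : ℝ, 0 < δ → ∀ N : ℕ, ∃ R : ℕ, N ≤ R ∧ ∀ a b c : ℕ, IsABCTriple a b c →
      rad a b c ≤ R → (c : ℝ) ≤ (R : ℝ) ^ (1 + δ)) :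
    ∀ ε : ℝ, 0 < ε → ∃ C : ℝ, 0 < C ∧
      ∀ a b c : ℕ, IsABCTriple a b c → (c : ℝ) < C * ((rad a b c : ℕ) : ℝ) ^ (1 + ε) := by
  intro ε hε
  set δ : ℝ := ε / 3 with hδ
  have hδ0 : 0 < δ := by positivity
  -- constants attached to `θ`
  have h2θ : (2:ℝ) ^ θ < 2 := by
    have := Real.rpow_lt_rpow_of_exponent_lt (by norm_num : (1:ℝ) < 2) hθ1
    rwa [Real.rpow_one] at this
  have h2θpos : 0 < (2:ℝ) ^ θ := by positivity
  set κ : ℝ := δ * (2 - (2:ℝ) ^ θ) with hκ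
  have hκ0 : 0 < κ := mul_pos hδ0 (by linarith)
  -- Step 1: a threshold `T` with `L + 2^θ t^θ ≤ κ t` for all `t ≥ T`.
  obtain ⟨B₁, hB₁0, hB₁⟩ :=
    rpow_le_linear_add_const hθ0 hθ1 (a := κ / (2 * (2:ℝ) ^ θ)) (by positivity)
  set T : ℝ := 2 * (L + (2:ℝ) ^ θ * B₁) / κ with hT
  have hT' : κ / 2 * T = L + (2:ℝ) ^ θ * B₁ := by
    rw [hT]; field_simp
  have hstep1 : ∀ t : ℝ, 0 ≤ t → T ≤ t → L + (2:ℝ) ^ θ * t ^ θ ≤ κ * t := by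
    intro t ht hTt
    have h1 := mul_le_mul_of_nonneg_left (hB₁ t ht) h2θpos.le
    have e : (2:ℝ) ^ θ * (κ / (2 * (2:ℝ) ^ θ) * t + B₁) = κ / 2 * t + (2:ℝ) ^ θ * B₁ := by
      field_simp
    have h3 := mul_le_mul_of_nonneg_left hTt (by positivity : (0:ℝ) ≤ κ / 2)
    linarith
  -- Step 2: a good scale `R ≥ max R₀ 2` with `log R ≥ T`.
  obtain ⟨R, hRN, hR⟩ := hgood δ hδ0 (max (max R₀ 2) ⌈Real.exp T⌉₊)
  have hR₀R : R₀ ≤ R := ((le_max_left _ _).trans (le_max_left _ _)).trans hRN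
  have hR2 : 2 ≤ R := ((le_max_right _ _).trans (le_max_left _ _)).trans hRN
  have hRT : ⌈Real.exp T⌉₊ ≤ R := (le_max_right _ _).trans hRN
  have hR1 : 1 ≤ R := by omega
  have hRpos : (0:ℝ) < R := by positivity
  have hR1' : (1:ℝ) < R := by exact_mod_cast hR2
  set t : ℝ := Real.log R with ht_def
  have htpos : 0 < t := Real.log_pos hR1'
  have hTt : T ≤ t := by
    have h1 : Real.exp T ≤ R := (Nat.le_ceil _).trans (by exact_mod_cast hRT)
    have := Real.log_le_log (Real.exp_pos T) h1
    rwa [Real.log_exp] at this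
  -- Step 3: the constants of `allScales`.
  have hβ : L + (2:ℝ) ^ θ * (Real.log R) ^ θ ≤ δ * t * (2 - (2:ℝ) ^ θ) := by
    have := hstep1 t htpos.le hTt
    rw [hκ] at this
    rw [← ht_def]; linarith
  have hβ0 : 0 ≤ δ * t := by positivity
  set φ : ℝ := (1 + θ) / 2 with hφ
  have hθφ : θ ≤ φ := by rw [hφ]; linarith
  have hφ0 : 0 < φ := by rw [hφ]; linarith
  have hφ1 : φ < 1 := by rw [hφ]; linarith
  have h2φ : (2:ℝ) ^ (-φ) < 1 := Real.rpow_lt_one_of_one_lt_of_neg (by norm_num) (by linarith)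
  have htθ : 0 < t ^ θ := Real.rpow_pos_of_pos htpos θ
  set γ : ℝ := (L + t ^ θ) / (1 - (2:ℝ) ^ (-φ)) with hγ_def
  have hγpos : 0 < γ := div_pos (by linarith) (by linarith)
  have hγ : L + (Real.log R) ^ θ ≤ γ * (1 - (2:ℝ) ^ (-φ)) := by
    rw [← ht_def, hγ_def, div_mul_cancel₀ _ (by linarith)]
  -- Step 4: the iteration, for the predicate "every abc triple with `rad ≤ S` has `c ≤ X`".
  have hall := allScales
    (fun (S : ℕ) (X : ℝ) => ∀ a b c : ℕ, IsABCTriple a b c → rad a b c ≤ S → (c : ℝ) ≤ X)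
    (b := (1 + δ) * t) hθ0 hθφ hL hβ0 hγpos.le hR₀R hR1 hβ hγ
    (fun S X Y hP hXY a b c h1 h2 => (hP a b c h1 h2).trans hXY)
    (by
      intro S₁ S₂ hS₁ hS₂ X₁ X₂ hX₁ hX₂ hP₁ hP₂ a b c habc hrad
      obtain ⟨a₁, b₁, c₁, a₂, b₂, c₂, h₁, hr₁, h₂, hr₂, hc⟩ := hsub S₁ S₂ hS₁ hS₂ a b c habc hrad
      have hc₁ : (c₁ : ℝ) ≤ X₁ := hP₁ a₁ b₁ c₁ h₁ hr₁
      have hc₂ : (c₂ : ℝ) ≤ X₂ := hP₂ a₂ b₂ c₂ h₂ hr₂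
      calc (c : ℝ) ≤ Real.exp L * Real.exp (Real.log ((S₁ : ℝ) * S₂) ^ θ) * c₁ * c₂ := hc
        _ ≤ Real.exp L * Real.exp (Real.log ((S₁ : ℝ) * S₂) ^ θ) * X₁ * X₂ := by gcongr)
    (by
      intro a b c habc hrad
      have := hR a b c habc hrad
      rwa [Real.rpow_def_of_pos hRpos, mul_comm] at this)
  -- Step 5: sublinearity of `N ↦ γ N^φ`.
  obtain ⟨B₂, hB₂0, hB₂⟩ :=
    rpow_le_linear_add_const hφ0.le hφ1 (a := δ * t / γ) (by positivity)
  set B : ℝ := (1 + 3 * δ) * t + γ * B₂ with hB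
  refine ⟨2 * Real.exp B, by positivity, ?_⟩
  intro a b c habc
  -- the least `N` with `rad ≤ R ^ N`
  set r : ℕ := rad a b c
  have hr2 : 2 ≤ r := habc.two_le_rad
  set N : ℕ := Nat.clog R r
  have hN1 : 1 ≤ N := Nat.clog_pos hR2 hr2
  have hrN : r ≤ R ^ N := Nat.le_pow_clog hR2 r
  have hlt : R ^ (N - 1) < r := by
    have := Nat.pow_pred_clog_lt_self hR2 (x := r) hr2
    simpa [Nat.pred_eq_sub_one] using this
  have hc : (c : ℝ) ≤ Real.exp (N * ((1 + δ) * t + δ * t) + γ * (N : ℝ) ^ φ) :=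
    hall N hN1 a b c habc hrN
  -- `N log R < log r + log R`
  have hr0 : 0 < r := by omega
  have hrpos : (0:ℝ) < r := by exact_mod_cast hr0
  set x : ℝ := Real.log r with hx_def
  have hNt : (N : ℝ) * t < x + t := by
    have h1 : ((R : ℝ)) ^ (N - 1) < r := by exact_mod_cast hlt
    have h2 := Real.log_lt_log (pow_pos hRpos _) h1
    rw [Real.log_pow, Nat.cast_sub hN1] at h2
    push_cast at h2
    rw [← ht_def, ← hx_def] at h2
    linarith
  -- assemble the exponent bound `≤ (1 + ε) x + B`
  have hN0 : (0:ℝ) ≤ N := Nat.cast_nonneg N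
  have hE1 : (N : ℝ) * ((1 + δ) * t + δ * t) ≤ (1 + 2 * δ) * (x + t) := by
    have := mul_le_mul_of_nonneg_left hNt.le (by positivity : (0:ℝ) ≤ 1 + 2 * δ)
    linarith
  have hE2 : γ * (N : ℝ) ^ φ ≤ δ * t * N + γ * B₂ := by
    have := mul_le_mul_of_nonneg_left (hB₂ N hN0) hγpos.le
    have e : γ * (δ * t / γ * N + B₂) = δ * t * N + γ * B₂ := by field_simp
    linarith
  have hE3 : δ * t * N ≤ δ * (x + t) := by
    have := mul_le_mul_of_nonneg_left hNt.le hδ0.le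
    linarith
  have hεx : ε * x = 3 * (δ * x) := by rw [hδ]; ring
  have hE : (N : ℝ) * ((1 + δ) * t + δ * t) + γ * (N : ℝ) ^ φ ≤ (1 + ε) * x + B := by
    rw [hB]; linarith
  have hexp : Real.exp ((1 + ε) * x + B) = Real.exp B * (r : ℝ) ^ (1 + ε) := by
    rw [Real.rpow_def_of_pos hrpos, ← Real.exp_add, hx_def]
    congr 1; ring
  have hpos : 0 < Real.exp B * (r : ℝ) ^ (1 + ε) :=
    mul_pos (Real.exp_pos _) (Real.rpow_pos_of_pos hrpos _)
  calc (c : ℝ) ≤ Real.exp ((1 + ε) * x + B) := hc.trans (Real.exp_le_exp.2 hE)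
    _ = Real.exp B * (r : ℝ) ^ (1 + ε) := hexp
    _ < 2 * Real.exp B * (r : ℝ) ^ (1 + ε) := by linarith

end Summit.ABC.ABC.Theorems.FeketeScalesAssembly

namespace Summit.ABC.ABC.Theorems

open Literature.NumberTheory.DiophantineGeometry in
/-- **`Assembly` holds** (route `FeketeScales`, item stmt-ABC-2165):
`ScaleSubmultiplicativity → SparseGoodScales → ABC`. Normalise the crux data
(`FeketeScalesAssembly.submult_normalise`: WLOG `0 ≤ θ`, `K = e^L` with `L ≥ 0`, `R₀ ≥ 2`) and
run the Fekete upgrade `FeketeScalesAssembly.abc_of_submult_of_sparseGoodScales`. -/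
theorem feketeScales_assembly_proof : Summit.ABC.ABC.Theses.FeketeScales.Assembly := by
  unfold Summit.ABC.ABC.Theses.FeketeScales.Assembly
  intro hsub hgood
  obtain ⟨θ, hθ1, K, hK, R₀, h⟩ := hsub
  exact FeketeScalesAssembly.abc_of_submult_of_sparseGoodScales (le_max_right θ 0)
    (max_lt hθ1 one_pos) (le_max_right _ _) (FeketeScalesAssembly.submult_normalise hK h) hgood

end Summit.ABC.ABC.Theorems
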